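import Summits.Ventures.Crystal3D.Theorems.StickyWulffConstantTextureLiminfTexShadowSplitDefs
import Summits.Ventures.Crystal3D.Theorems.StickyWulffConstantTextureLiminfLineCountGlueComb
import HarnessLib

/-!
# TexShadow v6.9 candidates: the generic wall law split by SUM-flux domination, and the covered part from line counts
# (LAYER-FLUX chain piece 6, booked cf-p1 ROUTE.md §86(72) BO; crux `TextureLiminf`, stmt-Ventures-19483)

HONEST FRAMING. Venture `Summits/Ventures/Crystal3D` (cell `crystal3d-full`), helper `--supports` the crux
`TextureLiminf` (stmt-Ventures-19483) of `route-Ventures-StickyWulffConstant`, registered line `TexShadow`.  Rung credit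
only; F-C1 not moved.  Definitions (for the planner's v6.9 re-cut, names at the planner's disposal) + two proved glues;
NOT the wall law, and the covered glue is CONDITIONAL on lane G's four-family line counts (hypothesis `hlines`).

v6.7 (`…TexShadowSplitDefs`) splits `BilayerWallGeneric` by `FluxDominated (√2/2)` (zigzag flux only).  With the in-layer
flux typed (`…LayerFluxDefs`, `…LayerCount`, `…CellFluxComb`, `…LineCountGlueComb`) the same split by
`SumFluxDominated (√2/2)` moves the near-in-plane orientations into the covered part:

* `BilayerWallSumCovered C R₀` / `BilayerWallSumZigzag C R₀` (+ `…From R`) — verbatim `BilayerWallCovered/Zigzag` with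
  `SumFluxDominated (Real.sqrt 2 / 2)` in place of `FluxDominated (Real.sqrt 2 / 2)`;
* `bilayerWallGeneric_of_sumTables` — sum-covered part + sum-zigzag part ⇒ `BilayerWallGenericFrom (max R_C R_Z)` (proved);
* **`bilayerWallSumCoveredFrom_of_lineCounts`** — `3 ≤ R` and lane G's four-family line counts `hlines` (zigzag lines of
  the machine selectors + in-layer rows, inner launch discs, one payer budget) ⇒ `BilayerWallSumCoveredFrom R` (proved, via
  `bilayerWallAt_of_lineCount_comb`).
* (appended) `sumFluxDominated_of_fluxDominated`, `bilayerWallCovered_of_sumCovered`, `bilayerWallCoveredFrom_of_sumCoveredFrom`,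
  `bilayerWallSumZigzag_of_zigzag` — v6.9's covered class contains v6.7's; its zigzag residual is contained in v6.7's.
WHAT THIS IS NOT: not F4, not E1, not the zigzag-deficit part; F-C1 not moved.
-/

noncomputable section

open scoped BigOperators InnerProductSpace ENNReal
open MeasureTheory Filter

namespace Summit.Ventures.Crystal3D.Cruxes.TextureLiminf.TexShadow

open Summit.Ventures.Crystal3D
open Literature.MathematicalPhysics.StatisticalMechanics (IsHaggSeq)

/-- **SUM-COVERED PART of the generic wall law at `(C, R₀)`**: the cell inequality for generic plate pairs and the
admissible charge tables that are SUM-flux-dominated at steepness `√2/2` (zigzag flux + in-layer flux of both plates). -/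
def BilayerWallSumCovered (C R₀ : ℝ) : Prop :=
  ∀ (σ₁ σ₂ : ℤ → ℤ), IsHaggSeq σ₁ → IsHaggSeq σ₂ →
    ∀ (L₁ L₂ : E3 ≃ₗᵢ[ℝ] E3) (s₁ s₂ : E3) (A₁ A₂ : ℤ → (E3 ≃ₗᵢ[ℝ] E3)) (u₁ u₂ : ℤ → E3),
    BilayerFramesAt L₁ s₁ σ₁ A₁ u₁ → BilayerFramesAt L₂ s₂ σ₂ A₂ u₂ →
    (∀ i j : ℤ, ¬ InResidualClass (A₁ i) (A₂ j) (u₁ i) (u₂ j)) →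
    ∀ (c : ℤ → ℤ → ℝ) (m : ℤ → ℤ → E3), BilayerChargeAdmissible A₁ A₂ c m →
      SumFluxDominated (Real.sqrt 2 / 2) L₁ σ₁ L₂ σ₂ c →
      BilayerWallAt C R₀ σ₁ σ₂ L₁ L₂ s₁ s₂ c

/-- **SUM-ZIGZAG-DEFICIT PART of the generic wall law at `(C, R₀)`**: the same for the admissible tables that are NOT
sum-flux-dominated (h-rich words at doubly deficient orientations). -/
def BilayerWallSumZigzag (C R₀ : ℝ) : Prop :=
  ∀ (σ₁ σ₂ : ℤ → ℤ), IsHaggSeq σ₁ → IsHaggSeq σ₂ →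
    ∀ (L₁ L₂ : E3 ≃ₗᵢ[ℝ] E3) (s₁ s₂ : E3) (A₁ A₂ : ℤ → (E3 ≃ₗᵢ[ℝ] E3)) (u₁ u₂ : ℤ → E3),
    BilayerFramesAt L₁ s₁ σ₁ A₁ u₁ → BilayerFramesAt L₂ s₂ σ₂ A₂ u₂ →
    (∀ i j : ℤ, ¬ InResidualClass (A₁ i) (A₂ j) (u₁ i) (u₂ j)) →
    ∀ (c : ℤ → ℤ → ℝ) (m : ℤ → ℤ → E3), BilayerChargeAdmissible A₁ A₂ c m →
      ¬ SumFluxDominated (Real.sqrt 2 / 2) L₁ σ₁ L₂ σ₂ c →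
      BilayerWallAt C R₀ σ₁ σ₂ L₁ L₂ s₁ s₂ c

/-- The sum-covered part holds FROM plate thickness `R` on. -/
def BilayerWallSumCoveredFrom (R : ℝ) : Prop := ∀ R₀ : ℝ, R ≤ R₀ → ∃ C : ℝ, BilayerWallSumCovered C R₀

/-- The sum-zigzag part holds FROM plate thickness `R` on. -/
def BilayerWallSumZigzagFrom (R : ℝ) : Prop := ∀ R₀ : ℝ, R ≤ R₀ → ∃ C : ℝ, BilayerWallSumZigzag C R₀

/-- **Glue (proved): sum-covered part + sum-zigzag part ⇒ generic part.** -/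
theorem bilayerWallGeneric_of_sumTables {R_C R_Z : ℝ} (hC1 : 1 ≤ R_C) (hC : BilayerWallSumCoveredFrom R_C)
    (hZ : BilayerWallSumZigzagFrom R_Z) : BilayerWallGenericFrom (max R_C R_Z) := by
  classical
  intro R₀ hR₀
  have hR₀C : R_C ≤ R₀ := le_trans (le_max_left _ _) hR₀
  have hR₀Z : R_Z ≤ R₀ := le_trans (le_max_right _ _) hR₀
  have hR₀0 : 0 ≤ R₀ := by linarith
  obtain ⟨C₁, hC₁⟩ := hC R₀ hR₀C
  obtain ⟨C₂, hC₂⟩ := hZ R₀ hR₀Z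
  refine ⟨max C₁ C₂, ?_⟩
  intro σ₁ σ₂ hσ₁ hσ₂ L₁ L₂ s₁ s₂ A₁ A₂ u₁ u₂ hu₁ hu₂ hgen c m hadm
  by_cases hflux : SumFluxDominated (Real.sqrt 2 / 2) L₁ σ₁ L₂ σ₂ c
  · exact bilayerWallAt_mono hR₀0 (le_max_left _ _)
      (hC₁ σ₁ σ₂ hσ₁ hσ₂ L₁ L₂ s₁ s₂ A₁ A₂ u₁ u₂ hu₁ hu₂ hgen c m hadm hflux)
  · exact bilayerWallAt_mono hR₀0 (le_max_right _ _)
      (hC₂ σ₁ σ₂ hσ₁ hσ₂ L₁ L₂ s₁ s₂ A₁ A₂ u₁ u₂ hu₁ hu₂ hgen c m hadm hflux)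

end Summit.Ventures.Crystal3D.Cruxes.TextureLiminf.TexShadow

namespace Summit.Ventures.Crystal3D.Theorems

open scoped InnerProductSpace
open Literature.MathematicalPhysics.StatisticalMechanics (IsHaggSeq triangularVec₁ triangularVec₂)
open Summit.Ventures.Crystal3D.Cruxes.TextureLiminf.TexShadow (E3 e₃ cyl stacking BilayerWallAt BilayerWallSumCovered
  BilayerWallSumCoveredFrom SumFluxDominated)

/-- **The sum-covered wall law from lane G's four-family line counts.**  See the module docstring. -/
theorem bilayerWallSumCoveredFrom_of_lineCounts (R : ℝ) (hR : 3 ≤ R)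
    (hlines : ∀ R₀ : ℝ, R ≤ R₀ → ∃ C_w : ℝ, ∀ (σ₁ σ₂ : ℤ → ℤ), IsHaggSeq σ₁ → IsHaggSeq σ₂ →
      ∀ (L₁ L₂ : E3 ≃ₗᵢ[ℝ] E3) (s₁ s₂ : E3),
      ∃ step₁ step₂ : ℤ → E3, IsZigSelector L₁ σ₁ e₃ step₁ ∧ IsZigSelector L₂ σ₂ (-e₃) step₂ ∧
      ∀ h : ℝ, 0 ≤ h → ∀ ρ : ℝ, R₀ ≤ ρ → ∀ X P₁ P₂ : Finset E3,
      (∀ p ∈ X, ∀ q ∈ X, p ≠ q → 1 ≤ dist p q) → P₁ ⊆ X → P₂ ⊆ X \ P₁ → (∀ p ∈ X, p ∈ cyl R₀ h ρ) →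
      (∀ p, p ∈ P₁ ↔ (p ∈ stacking L₁ s₁ σ₁ ∧ -(2 * R₀) ≤ p 2 ∧ p 2 ≤ -R₀ ∧ p 0 ^ 2 + p 1 ^ 2 ≤ ρ ^ 2)) →
      (∀ p, p ∈ P₂ ↔ (p ∈ stacking L₂ s₂ σ₂ ∧ h + R₀ ≤ p 2 ∧ p 2 ≤ h + 2 * R₀ ∧ p 0 ^ 2 + p 1 ^ 2 ≤ ρ ^ 2)) →
      ∃ (m : ℝ) (T₁ T₂ : Finset (Fin 2 → ℤ)) (T₃ T₄ : Finset (ℤ × ℤ)), 0 ≤ m ∧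
        (∀ t : Fin 2 → ℤ, (∃ k : ℤ,
          -R₀ - 4 ≤ (L₁ (zigVertexS step₁ k + ((t 0 : ℝ) • triangularVec₁ 1 + (t 1 : ℝ) • triangularVec₂ 1)) + s₁) 2 ∧
          (L₁ (zigVertexS step₁ k + ((t 0 : ℝ) • triangularVec₁ 1 + (t 1 : ℝ) • triangularVec₂ 1)) + s₁) 2 ≤ -R₀ - 3 ∧
          Real.sqrt ((L₁ (zigVertexS step₁ k + ((t 0 : ℝ) • triangularVec₁ 1 + (t 1 : ℝ) • triangularVec₂ 1)) + s₁) 0 ^ 2 +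
            (L₁ (zigVertexS step₁ k + ((t 0 : ℝ) • triangularVec₁ 1 + (t 1 : ℝ) • triangularVec₂ 1)) + s₁) 1 ^ 2) ≤ ρ - m) →
          t ∈ T₁) ∧
        (∀ t : Fin 2 → ℤ, (∃ k : ℤ,
          h + R₀ + 3 ≤ (L₂ (zigVertexS step₂ k + ((t 0 : ℝ) • triangularVec₁ 1 + (t 1 : ℝ) • triangularVec₂ 1)) + s₂) 2 ∧
          (L₂ (zigVertexS step₂ k + ((t 0 : ℝ) • triangularVec₁ 1 + (t 1 : ℝ) • triangularVec₂ 1)) + s₂) 2 ≤ h + R₀ + 4 ∧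
          Real.sqrt ((L₂ (zigVertexS step₂ k + ((t 0 : ℝ) • triangularVec₁ 1 + (t 1 : ℝ) • triangularVec₂ 1)) + s₂) 0 ^ 2 +
            (L₂ (zigVertexS step₂ k + ((t 0 : ℝ) • triangularVec₁ 1 + (t 1 : ℝ) • triangularVec₂ 1)) + s₂) 1 ^ 2) ≤ ρ - m) →
          t ∈ T₂) ∧
        (∀ kj : ℤ × ℤ, (∃ i : ℤ,
          -R₀ - 4 ≤ (L₁ (layerSite σ₁ L₁ e₃ kj.1 i kj.2) + s₁) 2 ∧ (L₁ (layerSite σ₁ L₁ e₃ kj.1 i kj.2) + s₁) 2 ≤ -R₀ - 3 ∧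
          Real.sqrt ((L₁ (layerSite σ₁ L₁ e₃ kj.1 i kj.2) + s₁) 0 ^ 2 + (L₁ (layerSite σ₁ L₁ e₃ kj.1 i kj.2) + s₁) 1 ^ 2) ≤
            ρ - m) → kj ∈ T₃) ∧
        (∀ kj : ℤ × ℤ, (∃ i : ℤ,
          h + R₀ + 3 ≤ (L₂ (layerSite σ₂ L₂ (-e₃) kj.1 i kj.2) + s₂) 2 ∧
          (L₂ (layerSite σ₂ L₂ (-e₃) kj.1 i kj.2) + s₂) 2 ≤ h + R₀ + 4 ∧
          Real.sqrt ((L₂ (layerSite σ₂ L₂ (-e₃) kj.1 i kj.2) + s₂) 0 ^ 2 +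
            (L₂ (layerSite σ₂ L₂ (-e₃) kj.1 i kj.2) + s₂) 1 ^ 2) ≤ ρ - m) → kj ∈ T₄) ∧
        (T₁.card : ℝ) + T₂.card + T₃.card + T₄.card + 36 * m * ρ ≤
          (∑ y ∈ X.filter (fun y => (X.filter fun q => dist y q = 1).card ≠ 12 ∧ -R₀ - 2 ≤ y 2 ∧ y 2 ≤ h + R₀ + 2),
            ((12 : ℝ) - ((X.filter fun q => dist y q = 1).card : ℝ))) + C_w * (1 + h) * ρ) :
    BilayerWallSumCoveredFrom R := by
  intro R₀ hR₀
  obtain ⟨C_w, hC⟩ := hlines R₀ hR₀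
  refine ⟨(C_w + 160 * (R₀ + 9) + 3456 + 1152 * (R₀ + 1)) / 2, ?_⟩
  intro σ₁ σ₂ hσ₁ hσ₂ L₁ L₂ s₁ s₂ A₁ A₂ u₁ u₂ _hA₁ _hA₂ _hgen c m hadm hflux
  obtain ⟨step₁, step₂, hsel₁, hsel₂, hF4⟩ := hC σ₁ σ₂ hσ₁ hσ₂ L₁ L₂ s₁ s₂
  have hτ : (1 : ℝ) / 4 ≤ Real.sqrt 2 / 2 := by
    have h1 : (1 : ℝ) ≤ Real.sqrt 2 := by
      rw [show (1 : ℝ) = Real.sqrt 1 by simp]; exact Real.sqrt_le_sqrt (by norm_num)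
    linarith
  exact bilayerWallAt_of_lineCount_comb hσ₁ hσ₂ L₁ L₂ s₁ s₂ (Real.sqrt 2 / 2) R₀ C_w hτ (le_trans hR hR₀) c hadm.1 hflux
    hsel₁ hsel₂ hF4

end Summit.Ventures.Crystal3D.Theorems


namespace Summit.Ventures.Crystal3D.Cruxes.TextureLiminf.TexShadow

/-- **Flux-dominated ⇒ sum-flux-dominated** (the in-layer flux is nonnegative): v6.9's covered class contains v6.7's. -/
theorem sumFluxDominated_of_fluxDominated {τ : ℝ} {L₁ : E3 ≃ₗᵢ[ℝ] E3} {σ₁ : ℤ → ℤ} {L₂ : E3 ≃ₗᵢ[ℝ] E3} {σ₂ : ℤ → ℤ}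
    {c : ℤ → ℤ → ℝ} (h : FluxDominated τ L₁ σ₁ L₂ σ₂ c) : SumFluxDominated τ L₁ σ₁ L₂ σ₂ c := by
  intro i j
  have h1 := h i j
  have h2 := layerFlux_nonneg τ L₁ e₃
  have h3 := layerFlux_nonneg τ L₂ (-e₃)
  linarith

/-- **The sum-covered part implies the (v6.7) covered part** at the same constants. -/
theorem bilayerWallCovered_of_sumCovered {C R₀ : ℝ} (h : BilayerWallSumCovered C R₀) : BilayerWallCovered C R₀ :=
  fun σ₁ σ₂ hσ₁ hσ₂ L₁ L₂ s₁ s₂ A₁ A₂ u₁ u₂ hu₁ hu₂ hgen c m hadm hflux =>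
    h σ₁ σ₂ hσ₁ hσ₂ L₁ L₂ s₁ s₂ A₁ A₂ u₁ u₂ hu₁ hu₂ hgen c m hadm (sumFluxDominated_of_fluxDominated hflux)

/-- … and FROM every thickness. -/
theorem bilayerWallCoveredFrom_of_sumCoveredFrom {R : ℝ} (h : BilayerWallSumCoveredFrom R) : BilayerWallCoveredFrom R :=
  fun R₀ hR₀ => (h R₀ hR₀).imp fun _ hC => bilayerWallCovered_of_sumCovered hC

/-- **The (v6.7) zigzag part implies the sum-zigzag part** (fewer tables to cover). -/
theorem bilayerWallSumZigzag_of_zigzag {C R₀ : ℝ} (h : BilayerWallZigzag C R₀) : BilayerWallSumZigzag C R₀ :=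
  fun σ₁ σ₂ hσ₁ hσ₂ L₁ L₂ s₁ s₂ A₁ A₂ u₁ u₂ hu₁ hu₂ hgen c m hadm hnot =>
    h σ₁ σ₂ hσ₁ hσ₂ L₁ L₂ s₁ s₂ A₁ A₂ u₁ u₂ hu₁ hu₂ hgen c m hadm (fun hflux => hnot (sumFluxDominated_of_fluxDominated hflux))

end Summit.Ventures.Crystal3D.Cruxes.TextureLiminf.TexShadow

end
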